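import Literature.NumberTheory.GaloisRepresentations.ResidualPair
import Literature.NumberTheory.GaloisRepresentations.StableLatticeValuationRing
import Literature.NumberTheory.GaloisRepresentations.GaloisRepFrobeniusProofs
import HarnessLib

/-!
# `HasResidualPair`: `p`-integrality of Frobenius polynomials; the clause is about the factorisation

Topic `Literature/NumberTheory/GaloisRepresentations`; proof-only companion of `ResidualPair.lean`
(`FramedGaloisRep.HasResidualPair`, `FramedGaloisRep.HasResidualSemisimplification`) and
`ResidualPairProofs.lean` (change of frame).  Written for definition item `defn-HasResidualPairVia`
of route `Langlands/PhantomRMYoshida`: the notion requested there as `HasResidualPairVia` is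
VERBATIM the accepted `FramedGaloisRep.HasResidualPair` (unfolding lemma `hasResidualPair_iff`,
symmetry `HasResidualPair.symm`, change of frame `hasResidualPair_conj_iff` /
`hasResidualPair_conj_left_iff` / `hasResidualPair_conj_right_iff`), so no new notion is
introduced; this file supplies the remaining requested API — "the automatic `p`-integrality of
`charpoly ρ(Frob_v)` for compact image, so that the `∃ P` clause is about the factorisation only":

* `FramedRep.exists_map_eq_charpoly_of_isOpen`, `FramedRep.exists_map_eq_charpoly` — for a
  compact group `G`, an open valuation subring `O` of a topological field `F` (resp. the valuation
  ring `𝒪[F]` of a valued field) and a continuous `ρ : G → GL_n(F)`, every `det(X - ρ(g))` lies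
  in `O[X]` (Serre 1968, Ch. I §1.1, Remark 1: `G` stabilises a lattice — the tree's
  `exists_integralModel_of_valuationSubring`, valid for the non-noetherian `ℤ̄_p ⊆ ℚ̄_p` — and
  `det(X - ρ(g)) = det(X - P⁻¹ρ(g)P)`); `FramedRep.map_eq_charpoly_unique`;
* `FramedGaloisRep.HasFrobCharpolyAt.unique`, `FramedGaloisRep.IsUnramifiedAt.hasFrobCharpolyAt_charpoly`,
  `FramedGaloisRep.IsUnramifiedAt.exists_hasFrobCharpolyAt` — framed forms of the discharged facts
  `GaloisRep.HasFrobCharpolyAt.unique_holds` / `GaloisRep.hasFrobCharpolyAt_frobCharpoly_holds`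
  (over a number field a Frobenius polynomial at `v` is unique, and exists at unramified `v`);
* `FramedGaloisRep.IsUnramifiedAt.exists_hasFrobCharpolyAt_map` — for `ρ : Γ_K → GL_n(ℚ̄_p)`
  unramified at `v` there is `P ∈ ℤ̄_p[X]` with `ρ.HasFrobCharpolyAt v P` (`Γ_K` is compact, so
  Serre's Remark applies); it is unique (`FramedGaloisRep.HasFrobCharpolyAt.unique_map`);
* `FramedGaloisRep.hasResidualPair_iff_forall` — hence in `HasResidualPair red σ σ'` the clause
  `∃ P P₁ P₂, … ∧ P.map red = P₁ * P₂` may be replaced by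
  `∀ P P₁ P₂, … → P.map red = P₁ * P₂`: the polynomials exist and are unique, only the
  factorisation `P̄ = P₁ P₂` is a condition; `HasResidualPair.map_eq_mul` (consumer form) and
  `hasResidualSemisimplification_iff_forall`;
* `FramedGaloisRep.hasResidualPair_of_frobenius` — constructor: it suffices to exhibit, at each
  place outside a finite set, ONE arithmetic Frobenius `g` and `P ∈ ℤ̄_p[X]` with
  `P = det(X - ρ(g))` and `P̄ = det(X - σ(g)) det(X - σ'(g))`;
  `hasResidualSemisimplification_of_frobenius`.

Everything here is PROVED (theorems only; no new definitions or named facts).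

## References
* J.-P. Serre, *Abelian ℓ-adic representations and elliptic curves* (1968), Ch. I §1.1 Remark 1
  (compact groups stabilise a lattice), §2.1 and §2.3 (the Frobenius polynomials `P_{v,ρ}`).
  [SerreAbelianLadic1968]
* P. Deligne, J.-P. Serre, Formes modulaires de poids 1, Ann. Sci. ÉNS 7 (1974), §6 (reduction
  mod `λ` and semisimplification read off characteristic polynomials, Brauer–Nesbitt). [DeligneSerre1974]
-/

noncomputable section

open Field IsDedekindDomain Filter
open scoped NumberField Valued MatrixGroups

namespace Literature.NumberTheory.GaloisRepresentations

/-! ### Characteristic polynomials of a compact group of matrices are integral -/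

section Integrality

universe u v

variable {F : Type u} [Field F] {G : Type*} [Group G] [TopologicalSpace G] {n : ℕ}

/-- The integral polynomial lifting `det(X - ρ(g))` along a subring `O ⊆ F` is unique (the
inclusion is injective, Mathlib `Polynomial.map_injective`). [folklore] -/
theorem FramedRep.map_eq_charpoly_unique [TopologicalSpace F] {O : Subring F} {ρ : FramedRep G F n}
    {g : G} {P Q : Polynomial O} (hP : P.map O.subtype = ρ.charpoly g)
    (hQ : Q.map O.subtype = ρ.charpoly g) : P = Q :=
  Polynomial.map_injective _ Subtype.val_injective (hP.trans hQ.symm)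

variable [IsTopologicalGroup G] [CompactSpace G]

/-- **Characteristic polynomials of a compact group of matrices are integral** (open valuation
subring form).  Let `O ⊆ F` be an open valuation subring of a topological field (no noetherian
hypothesis: e.g. `ℤ̄_p ⊆ ℚ̄_p`), `G` a compact topological group and `ρ : G → GL_n(F)` continuous.
Then `det(X - ρ(g)) ∈ O[X]` for every `g ∈ G`: `G` stabilises an `O`-lattice (Serre 1968, Ch. I
§1.1, Remark 1; the tree's `exists_integralModel_of_valuationSubring`), i.e. `P⁻¹ ρ P` is
`GL_n(O)`-valued for some `P`, and `det(X - P⁻¹ρ(g)P) = det(X - ρ(g))` (`charpoly_integralModel`).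
[cite: SerreAbelianLadic1968, Ch. I §1.1 Remark 1] -/
theorem FramedRep.exists_map_eq_charpoly_of_isOpen [TopologicalSpace F] {O : ValuationSubring F}
    (hO : IsOpen (O : Set F)) (ρ : FramedRep G F n) (g : G) :
    ∃ P : Polynomial O, P.map O.subtype = ρ.charpoly g := by
  obtain ⟨Q, ρ₀, h⟩ := exists_integralModel_of_valuationSubring hO ρ
  exact ⟨_, charpoly_integralModel h g⟩

/-- **Characteristic polynomials of a compact group of matrices are integral** (valued field
form).  For a valued field `F` with valuation ring `𝒪[F] = Valued.integer F` (open: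
Mathlib `Valued.isOpen_valuationSubring`), a compact group `G` and a continuous `ρ : G → GL_n(F)`,
every `det(X - ρ(g))` lies in `𝒪[F][X]`.  Serre 1968, Ch. I §1.1 Remark 1.
[cite: SerreAbelianLadic1968, Ch. I §1.1 Remark 1] -/
theorem FramedRep.exists_map_eq_charpoly {Γ₀ : Type v} [LinearOrderedCommGroupWithZero Γ₀]
    [Valued F Γ₀] (ρ : FramedRep G F n) (g : G) :
    ∃ P : Polynomial 𝒪[F], P.map (𝒪[F]).subtype = ρ.charpoly g := by
  obtain ⟨P, hP⟩ := ρ.exists_map_eq_charpoly_of_isOpen (Valued.isOpen_valuationSubring F) g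
  exact ⟨P, hP⟩

end Integrality

/-! ### Frobenius polynomials of framed representations: uniqueness, existence, integrality -/

namespace FramedGaloisRep

section Frobenius

universe u v

variable {K : Type u} [Field K] [NumberField K] {A : Type v} [CommRing A] [TopologicalSpace A]
  {n : ℕ}

/-- **Uniqueness of the Frobenius polynomial (framed form).**  Over a number field two polynomials
`P`, `Q` with `ρ.HasFrobCharpolyAt v P`, `ρ.HasFrobCharpolyAt v Q` coincide: there is a prime
`𝔓 ∣ v` of `ℤ̄_K` (`primesAbove_nonempty`) and an arithmetic Frobenius at it
(`exists_isArithFrobAt_of_mem_primesAbove_holds`), and both are its characteristic polynomial.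
Framed companion of `GaloisRep.HasFrobCharpolyAt.unique_holds`.
Serre 1968, Ch. I §2.1. [folklore] -/
theorem HasFrobCharpolyAt.unique {v : HeightOneSpectrum (𝓞 K)} {ρ : FramedGaloisRep K A n}
    {P Q : Polynomial A} (hP : ρ.HasFrobCharpolyAt v P) (hQ : ρ.HasFrobCharpolyAt v Q) :
    P = Q := by
  obtain ⟨𝔓, h𝔓⟩ := v.primesAbove_nonempty
  obtain ⟨σ, hσ⟩ := HeightOneSpectrum.exists_isArithFrobAt_of_mem_primesAbove_holds h𝔓
  rw [← hP 𝔓 h𝔓 σ hσ, ← hQ 𝔓 h𝔓 σ hσ]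

variable [IsTopologicalRing A]

/-- **At an unramified place the characteristic polynomial of any arithmetic Frobenius is the
Frobenius polynomial (framed form)**: if `ρ` is unramified at `v` and `g` is an arithmetic
Frobenius at some `𝔓 ∣ v`, then `ρ.HasFrobCharpolyAt v (det(X - ρ(g)))`.  Framed companion of
`GaloisRep.IsUnramifiedAt.hasFrobCharpolyAt_charpoly` (through `ρ.toGaloisRep`,
`isUnramifiedAt_toGaloisRep_iff`, `hasFrobCharpolyAt_toGaloisRep_iff`).
Serre 1968, Ch. I §2.1 ("`P_{v,ρ}` depends only on `v`"). [folklore] -/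
theorem IsUnramifiedAt.hasFrobCharpolyAt_charpoly {v : HeightOneSpectrum (𝓞 K)}
    {ρ : FramedGaloisRep K A n} (h : ρ.IsUnramifiedAt v) {𝔓 : Ideal (absIntegers (𝓞 K) K)}
    (h𝔓 : 𝔓 ∈ v.primesAbove) {g : absoluteGaloisGroup K} (hg : IsArithFrobAt (𝓞 K) g 𝔓) :
    ρ.HasFrobCharpolyAt v (FramedRep.charpoly ρ g) := by
  have hQ : ρ.HasFrobCharpolyAt v (ρ.toGaloisRep g).charpoly :=
    (hasFrobCharpolyAt_toGaloisRep_iff v _ ρ).mp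
      (((isUnramifiedAt_toGaloisRep_iff v ρ).mpr h).hasFrobCharpolyAt_charpoly h𝔓 hg)
  rw [hQ 𝔓 h𝔓 g hg]
  exact hQ

/-- **Existence of the Frobenius polynomial at unramified places (framed form)**: if `ρ` is
unramified at `v` then `ρ.HasFrobCharpolyAt v P` for some `P` (namely `det(X - ρ(g))` for any
arithmetic Frobenius `g` at any `𝔓 ∣ v`).  Framed companion of
`GaloisRep.hasFrobCharpolyAt_frobCharpoly_holds`. Serre 1968, Ch. I §2.1. [folklore] -/
theorem IsUnramifiedAt.exists_hasFrobCharpolyAt {v : HeightOneSpectrum (𝓞 K)}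
    {ρ : FramedGaloisRep K A n} (h : ρ.IsUnramifiedAt v) : ∃ P, ρ.HasFrobCharpolyAt v P := by
  obtain ⟨𝔓, h𝔓⟩ := v.primesAbove_nonempty
  obtain ⟨g, hg⟩ := HeightOneSpectrum.exists_isArithFrobAt_of_mem_primesAbove_holds h𝔓
  exact ⟨_, h.hasFrobCharpolyAt_charpoly h𝔓 hg⟩

variable {p : ℕ} [Fact p.Prime]

/-- **Frobenius polynomials of `p`-adic Galois representations are `p`-integral.**  For a number
field `K` and a continuous `ρ : Γ_K → GL_n(ℚ̄_p)` unramified at `v`, there is `P ∈ ℤ̄_p[X]`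
(`ℤ̄_p = 𝒪[ℚ̄_p] = Valued.integer (PadicAlgCl p)`) with `ρ.HasFrobCharpolyAt v P`: `Γ_K` is
compact, so all `det(X - ρ(g))` are integral (`FramedRep.exists_map_eq_charpoly`, Serre 1968,
Ch. I §1.1 Remark 1), in particular that of an arithmetic Frobenius at `v`, which is the Frobenius
polynomial since `ρ` is unramified there (`IsUnramifiedAt.hasFrobCharpolyAt_charpoly`).
[cite: SerreAbelianLadic1968, Ch. I §1.1 Remark 1] -/
theorem IsUnramifiedAt.exists_hasFrobCharpolyAt_map {v : HeightOneSpectrum (𝓞 K)}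
    {ρ : FramedGaloisRep K (PadicAlgCl p) n} (h : ρ.IsUnramifiedAt v) :
    ∃ P : Polynomial 𝒪[PadicAlgCl p],
      ρ.HasFrobCharpolyAt v (P.map (𝒪[PadicAlgCl p]).subtype) := by
  obtain ⟨𝔓, h𝔓⟩ := v.primesAbove_nonempty
  obtain ⟨g, hg⟩ := HeightOneSpectrum.exists_isArithFrobAt_of_mem_primesAbove_holds h𝔓
  obtain ⟨P, hP⟩ := FramedRep.exists_map_eq_charpoly ρ g
  exact ⟨P, hP ▸ h.hasFrobCharpolyAt_charpoly h𝔓 hg⟩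

/-- The integral Frobenius polynomial of `ρ : Γ_K → GL_n(ℚ̄_p)` at `v` is unique. [folklore] -/
theorem HasFrobCharpolyAt.unique_map {v : HeightOneSpectrum (𝓞 K)}
    {ρ : FramedGaloisRep K (PadicAlgCl p) n} {P Q : Polynomial 𝒪[PadicAlgCl p]}
    (hP : ρ.HasFrobCharpolyAt v (P.map (𝒪[PadicAlgCl p]).subtype))
    (hQ : ρ.HasFrobCharpolyAt v (Q.map (𝒪[PadicAlgCl p]).subtype)) : P = Q :=
  Polynomial.map_injective _ Subtype.val_injective (hP.unique hQ)

end Frobenius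

/-! ### `HasResidualPair`: the `∃ P` clause is about the factorisation only -/

section ResidualPair

variable {K : Type} [Field K] {p : ℕ} [Fact p.Prime]
variable {k : Type*} [Field k] [TopologicalSpace k]
variable {n a b : ℕ}
variable {ρ : FramedGaloisRep K (PadicAlgCl p) n} {red : 𝒪[PadicAlgCl p] →+* k}
  {σ : FramedGaloisRep K k a} {σ' : FramedGaloisRep K k b} {τ : FramedGaloisRep K k n}

/-- **Consumer form of `HasResidualPair`.**  Over a number field, if `ρ.HasResidualPair red σ σ'`
then at almost all `v`, for EVERY integral Frobenius polynomial `P` of `ρ` and all Frobenius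
polynomials `P₁`, `P₂` of `σ`, `σ'` at `v`, `P̄ = P₁ P₂` (the polynomials in the defining `∃`
clause are unique: `HasFrobCharpolyAt.unique_map`, `HasFrobCharpolyAt.unique`). [folklore] -/
theorem HasResidualPair.map_eq_mul [NumberField K] (h : ρ.HasResidualPair red σ σ') :
    ∀ᶠ v in cofinite, ∀ (P : Polynomial 𝒪[PadicAlgCl p]) (P₁ P₂ : Polynomial k),
      ρ.HasFrobCharpolyAt v (P.map (𝒪[PadicAlgCl p]).subtype) →
        σ.HasFrobCharpolyAt v P₁ → σ'.HasFrobCharpolyAt v P₂ → P.map red = P₁ * P₂ := by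
  refine h.mono fun v hv P' P₁' P₂' hP' hP₁' hP₂' => ?_
  obtain ⟨-, -, -, P, P₁, P₂, hP, hP₁, hP₂, hred⟩ := hv
  rw [hP'.unique_map hP, hP₁'.unique hP₁, hP₂'.unique hP₂, hred]

/-- **`HasResidualPair` is a condition on the factorisation only.**  Over a number field (and for
a topological coefficient field `k`), `ρ.HasResidualPair red σ σ'` iff at almost all `v` the three
representations are unramified and `P̄ = P₁ P₂` for ALL `P ∈ ℤ̄_p[X]`, `P₁, P₂ ∈ k[X]` which are
Frobenius polynomials of `ρ`, `σ`, `σ'` at `v`: such polynomials exist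
(`IsUnramifiedAt.exists_hasFrobCharpolyAt_map` — `p`-integrality for compact image —,
`IsUnramifiedAt.exists_hasFrobCharpolyAt`) and are unique (`HasFrobCharpolyAt.unique_map`,
`HasFrobCharpolyAt.unique`).  Serre 1968, Ch. I §2.3. [folklore] -/
theorem hasResidualPair_iff_forall [NumberField K] [IsTopologicalRing k] :
    ρ.HasResidualPair red σ σ' ↔
      ∀ᶠ v in cofinite, ρ.IsUnramifiedAt v ∧ σ.IsUnramifiedAt v ∧ σ'.IsUnramifiedAt v ∧
        ∀ (P : Polynomial 𝒪[PadicAlgCl p]) (P₁ P₂ : Polynomial k),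
          ρ.HasFrobCharpolyAt v (P.map (𝒪[PadicAlgCl p]).subtype) →
            σ.HasFrobCharpolyAt v P₁ → σ'.HasFrobCharpolyAt v P₂ → P.map red = P₁ * P₂ := by
  refine Filter.eventually_congr (Filter.Eventually.of_forall fun v => ?_)
  refine and_congr_right fun hρ => and_congr_right fun hσ => and_congr_right fun hσ' => ?_
  constructor
  · rintro ⟨P, P₁, P₂, hP, hP₁, hP₂, hred⟩ P' P₁' P₂' hP' hP₁' hP₂'
    rw [hP'.unique_map hP, hP₁'.unique hP₁, hP₂'.unique hP₂, hred]
  · intro H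
    obtain ⟨P, hP⟩ := hρ.exists_hasFrobCharpolyAt_map
    obtain ⟨P₁, hP₁⟩ := hσ.exists_hasFrobCharpolyAt
    obtain ⟨P₂, hP₂⟩ := hσ'.exists_hasFrobCharpolyAt
    exact ⟨P, P₁, P₂, hP, hP₁, hP₂, H P P₁ P₂ hP hP₁ hP₂⟩

/-- **`HasResidualSemisimplification` is a condition on the reduction only** (one-piece version
of `hasResidualPair_iff_forall`). [folklore] -/
theorem hasResidualSemisimplification_iff_forall [NumberField K] [IsTopologicalRing k] :
    ρ.HasResidualSemisimplification red τ ↔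
      ∀ᶠ v in cofinite, ρ.IsUnramifiedAt v ∧ τ.IsUnramifiedAt v ∧
        ∀ (P : Polynomial 𝒪[PadicAlgCl p]) (Q : Polynomial k),
          ρ.HasFrobCharpolyAt v (P.map (𝒪[PadicAlgCl p]).subtype) →
            τ.HasFrobCharpolyAt v Q → P.map red = Q := by
  refine Filter.eventually_congr (Filter.Eventually.of_forall fun v => ?_)
  refine and_congr_right fun hρ => and_congr_right fun hτ => ?_
  constructor
  · rintro ⟨P, Q, hP, hQ, hred⟩ P' Q' hP' hQ'
    rw [hP'.unique_map hP, hQ'.unique hQ, hred]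
  · intro H
    obtain ⟨P, hP⟩ := hρ.exists_hasFrobCharpolyAt_map
    obtain ⟨Q, hQ⟩ := hτ.exists_hasFrobCharpolyAt
    exact ⟨P, Q, hP, hQ, H P Q hP hQ⟩

/-- **Constructor: `HasResidualPair` from one Frobenius per place.**  Over a number field, to
prove `ρ.HasResidualPair red σ σ'` it suffices to give a finite set `S` of places and, at each
`v ∉ S` (all three representations being unramified there), ONE arithmetic Frobenius `g` at some
`𝔓 ∣ v` together with `P ∈ ℤ̄_p[X]` lifting `det(X - ρ(g))` and reducing to
`det(X - σ(g)) · det(X - σ'(g))` — the other Frobenii at `v` have the same characteristic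
polynomials (`IsUnramifiedAt.hasFrobCharpolyAt_charpoly`).  This is how the relation is read off
in practice (Deligne–Serre 1974, §6; Serre 1968, Ch. I §2.3). [folklore] -/
theorem hasResidualPair_of_frobenius [NumberField K] [IsTopologicalRing k]
    {S : Set (HeightOneSpectrum (𝓞 K))} (hS : S.Finite)
    (h : ∀ v ∉ S, ρ.IsUnramifiedAt v ∧ σ.IsUnramifiedAt v ∧ σ'.IsUnramifiedAt v ∧
      ∃ 𝔓 ∈ v.primesAbove, ∃ g : absoluteGaloisGroup K, IsArithFrobAt (𝓞 K) g 𝔓 ∧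
        ∃ P : Polynomial 𝒪[PadicAlgCl p], P.map (𝒪[PadicAlgCl p]).subtype = FramedRep.charpoly ρ g ∧
          P.map red = FramedRep.charpoly σ g * FramedRep.charpoly σ' g) :
    ρ.HasResidualPair red σ σ' := by
  refine (hS.eventually_cofinite_notMem).mono fun v hv => ?_
  obtain ⟨hρ, hσ, hσ', 𝔓, h𝔓, g, hg, P, hP, hred⟩ := h v hv
  exact ⟨hρ, hσ, hσ', P, _, _, hP ▸ hρ.hasFrobCharpolyAt_charpoly h𝔓 hg,
    hσ.hasFrobCharpolyAt_charpoly h𝔓 hg, hσ'.hasFrobCharpolyAt_charpoly h𝔓 hg, hred⟩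

/-- **Constructor: `HasResidualSemisimplification` from one Frobenius per place** (one-piece
version of `hasResidualPair_of_frobenius`). [folklore] -/
theorem hasResidualSemisimplification_of_frobenius [NumberField K] [IsTopologicalRing k]
    {S : Set (HeightOneSpectrum (𝓞 K))} (hS : S.Finite)
    (h : ∀ v ∉ S, ρ.IsUnramifiedAt v ∧ τ.IsUnramifiedAt v ∧
      ∃ 𝔓 ∈ v.primesAbove, ∃ g : absoluteGaloisGroup K, IsArithFrobAt (𝓞 K) g 𝔓 ∧
        ∃ P : Polynomial 𝒪[PadicAlgCl p], P.map (𝒪[PadicAlgCl p]).subtype = FramedRep.charpoly ρ g ∧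
          P.map red = FramedRep.charpoly τ g) :
    ρ.HasResidualSemisimplification red τ := by
  refine (hS.eventually_cofinite_notMem).mono fun v hv => ?_
  obtain ⟨hρ, hτ, 𝔓, h𝔓, g, hg, P, hP, hred⟩ := h v hv
  exact ⟨hρ, hτ, P, _, hP ▸ hρ.hasFrobCharpolyAt_charpoly h𝔓 hg,
    hτ.hasFrobCharpolyAt_charpoly h𝔓 hg, hred⟩

end ResidualPair

end FramedGaloisRep

end Literature.NumberTheory.GaloisRepresentations
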